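import Summits.AnomalousDissipation.AnomalousDissipation.Theorems.QuarticTightness.Negative.Anatomy
import Literature.Analysis.FluidPDE.GalerkinFlow
import Literature.Analysis.FunctionSpaces.TorusHNegOnePairing

/-!
# Stub `stub_absorbingBall` (S5) of the line `horizon-shooting` (payload `Ideate3Sketch`)
# for the crux `MomentParity.QuarticTightness` (stmt-AnomalousDissipation-14331)

Sorry-free discharge of the registered stub `stub_absorbingBall` of the lead's skeleton: for the
level-`N` Galerkin semiflow `Torus.galerkinFlow ν f N` of the Navier–Stokes equations on `T³`
(`ν > 0`, smooth steady force `f`), every `L²` ball of radius `R ≥ ‖f‖₂ / (4π²ν)` (the absorbing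
radius) is FORWARD INVARIANT along orbits of Galerkin modes whose slices have zero mean:
`‖a‖₂² ≤ R² ⟹ ‖galerkinFlow ν f N t a‖₂² ≤ R²` for all `t ≥ 0`.

**Proof (coefficient level).** On a Galerkin mode `a` the slice at time `τ` is the real
trigonometric polynomial `realTrigPoly S (coeffExt S (α τ))`, `S = freqBall N`, of the coefficient
orbit `α τ := galerkinCoeffFlow ν (f̂|_S) τ (â|_S)` (`IsGalerkinMode.galerkinFlow_eq`), a global
solution of the Galerkin ODE (`isGalerkinODESolution_galerkinCoeffFlow`). By Parseval
`ψ τ := Σ_k ‖α τ k‖² = ‖u_τ‖₂²`, and the energy identity in differential form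
(`hasDerivWithinAt_energy`) gives `ψ' = 2(−ν‖∇u_τ‖² + ∫⟪P_N f, u_τ⟫)`. Two slice estimates:
Poincaré `‖∇u_τ‖² = 4π² Σ_k |k|² ‖α τ k‖² ≥ 4π² ψ τ` because the mean mode `α τ 0` vanishes
(zero mean of the slice, `Torus.mFourierCoeff_complexify_zero_of_hasZeroMean`) and `|k|² ≥ 1`
for `k ≠ 0`; and Cauchy–Schwarz plus Bessel `∫⟪P_N f, u_τ⟫ ≤ ‖P_N f‖₂ √ψ ≤ ‖f‖₂ √ψ`. Hence
`ψ' ≤ 2√ψ (‖f‖₂ − 4π²ν√ψ) < 0` on every sphere `ψ = (R + δ)²`, `δ > 0` (as `‖f‖₂ ≤ 4π²ν R`), so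
the barrier lemma `image_le_of_deriv_right_lt_deriv_boundary'` keeps `ψ ≤ (R + δ)²` on `[0, t]`;
let `δ → 0`.

References: Constantin–Foias, *Navier–Stokes Equations* (Chicago 1988), Ch. 8, (8.7)–(8.9)
(energy inequality and absorbing ball of the Galerkin system); Robinson–Rodrigo–Sadowski,
*The three-dimensional Navier–Stokes equations* (CUP 2016), Thm. 4.4 Step 2, (4.6)–(4.8);
Temam, *Infinite-Dimensional Dynamical Systems in Mechanics and Physics* (Springer 1997),
Ch. III, §2.2 (absorbing balls in `H`).
-/

open MeasureTheory Filter Topology Set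
open scoped ENNReal InnerProductSpace RealInnerProductSpace
open Literature.Analysis.FunctionSpaces Literature.Analysis.FluidPDE
open Summit.AnomalousDissipation.AnomalousDissipation.Theorems
open Summit.AnomalousDissipation.AnomalousDissipation.Theorems.QuarticGate.Negative
-- `T3 = UnitAddTorus (Fin 3)`, `R3 = EuclideanSpace ℝ (Fin 3)`, `H3 = ↥(Torus.energySpace (Fin 3))`, `L2T3 = ↥(Lp R3 2 volume)`
open Summit.AnomalousDissipation.AnomalousDissipation.Theorems.CubicParityLoud.Negative (T3 R3 H3 L2T3)
set_option linter.dupNamespace false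
noncomputable section

namespace Summit.AnomalousDissipation.AnomalousDissipation.Theorems.MomentParityQuarticTightness

/-- **Poincaré at coefficient level.** If the mean mode of a coefficient family vanishes,
`Σ_{k∈S} ‖c k‖² ≤ Σ_{k∈S} |k|² ‖c k‖²` (`|k|² ≥ 1` for `k ≠ 0`). [folklore] -/
private theorem sum_norm_sq_le_sum_freqNormSq_mul {S : Finset (Fin 3 → ℤ)}
    {c : (Fin 3 → ℤ) → EuclideanSpace ℂ (Fin 3)} (hc0 : c 0 = 0) :
    ∑ k ∈ S, ‖c k‖ ^ 2 ≤ ∑ k ∈ S, Torus.freqNormSq k * ‖c k‖ ^ 2 := by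
  refine Finset.sum_le_sum fun k _ => ?_
  by_cases hk : k = 0
  · subst hk
    simp [hc0]
  · have h1 : 1 ≤ Torus.freqNormSq k := Torus.one_le_freqNormSq_of_ne_zero hk
    have h2 : 0 ≤ ‖c k‖ ^ 2 := sq_nonneg _
    nlinarith

/-- **Cauchy–Schwarz at coefficient level**:
`Σ_{k∈S} Re⟪c k, c' k⟫ ≤ (Σ_{k∈S} ‖c k‖²)^{1/2} (Σ_{k∈S} ‖c' k‖²)^{1/2}`. [folklore] -/
private theorem sum_re_inner_le_sqrt_mul_sqrt (S : Finset (Fin 3 → ℤ))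
    (c c' : (Fin 3 → ℤ) → EuclideanSpace ℂ (Fin 3)) :
    ∑ k ∈ S, (⟪c k, c' k⟫_ℂ).re ≤
      Real.sqrt (∑ k ∈ S, ‖c k‖ ^ 2) * Real.sqrt (∑ k ∈ S, ‖c' k‖ ^ 2) := by
  refine (Finset.sum_le_sum fun k _ => ?_).trans
    (Real.sum_mul_le_sqrt_mul_sqrt S (fun k => ‖c k‖) fun k => ‖c' k‖)
  exact re_inner_le_norm (𝕜 := ℂ) (c k) (c' k)

/-- **The absorbing ball of the Galerkin ODE, coefficient level** (Constantin–Foias 1988, Ch. 8,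
(8.7)–(8.9); Temam 1997, Ch. III, §2.2). Let `α` be a global solution of the Galerkin ODE on a
symmetric frequency set `S ∋ 0` with `ν > 0` and real force coefficients `g`, whose mean mode
`α τ 0` vanishes for `τ ≥ 0`. If `Σ_k ‖g k‖² ≤ Φ²` with `0 ≤ Φ ≤ 4π²ν R` and
`Σ_k ‖α 0 k‖² ≤ R²`, then `Σ_k ‖α t k‖² ≤ R²` for every `t ≥ 0`: the energy
`ψ = Σ_k ‖α k‖²` has derivative `2(−ν‖∇u‖² + ∫⟪G, u⟫) ≤ 2√ψ (Φ − 4π²ν√ψ)`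
(`hasDerivWithinAt_energy`, Poincaré on the mean-free modes, Cauchy–Schwarz), which is negative
on every sphere `ψ = (R + δ)²`, `δ > 0`; barrier (`image_le_of_deriv_right_lt_deriv_boundary'`)
and `δ → 0`. [folklore; Constantin–Foias 1988, Ch. 8, (8.9)] -/
private theorem sum_norm_sq_le_of_barrier {S : Finset (Fin 3 → ℤ)} (hS : ∀ k ∈ S, -k ∈ S)
    (h0S : (0 : Fin 3 → ℤ) ∈ S) {ν : ℝ} (hν : 0 < ν) {g c₀ : ↥S → EuclideanSpace ℂ (Fin 3)}
    {α : ℝ → ↥S → EuclideanSpace ℂ (Fin 3)} (hg : Torus.IsRealCoeff g)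
    (hsol : IsGalerkinODESolution ν g c₀ α) (hzero : ∀ τ, 0 ≤ τ → α τ ⟨0, h0S⟩ = 0)
    {Φ R : ℝ} (hΦ0 : 0 ≤ Φ) (hgΦ : ∑ k, ‖g k‖ ^ 2 ≤ Φ ^ 2)
    (hΦR : Φ ≤ 4 * Real.pi ^ 2 * ν * R) (hc₀R : ∑ k, ‖c₀ k‖ ^ 2 ≤ R ^ 2) {t : ℝ} (ht : 0 ≤ t) :
    ∑ k, ‖α t k‖ ^ 2 ≤ R ^ 2 := by
  have hπν : 0 < 4 * Real.pi ^ 2 * ν := by positivity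
  have hR0 : 0 ≤ R := nonneg_of_mul_nonneg_right (hΦ0.trans hΦR) hπν
  have hgs : Torus.IsConjSymm (Torus.coeffExt S g) := hg.isConjSymm_coeffExt hS
  have hcs : ∀ τ, Torus.IsConjSymm (Torus.coeffExt S (α τ)) := fun τ =>
    (hsol.mem τ).1.isConjSymm_coeffExt hS
  have hc0 : ∀ τ, 0 ≤ τ → Torus.coeffExt S (α τ) 0 = 0 := fun τ hτ => by
    rw [Torus.coeffExt_of_mem _ h0S]
    exact hzero τ hτ
  have hgS : ∑ k ∈ S, ‖Torus.coeffExt S g k‖ ^ 2 ≤ Φ ^ 2 :=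
    (Torus.sum_coeffExt (fun _ v => ‖v‖ ^ 2) g).trans_le hgΦ
  -- the energy of the orbit and its derivative along the Galerkin ODE
  set ψ : ℝ → ℝ := fun τ => ∑ k, ‖α τ k‖ ^ 2 with hψ
  set ψ' : ℝ → ℝ := fun τ =>
    2 * (-(ν * (Torus.eGradNormSq (Torus.realTrigPoly S (Torus.coeffExt S (α τ)))).toReal) +
      ∫ x, ⟪Torus.realTrigPoly S (Torus.coeffExt S g) x,
        Torus.realTrigPoly S (Torus.coeffExt S (α τ)) x⟫_ℝ) with hψ'
  have hψS : ∀ τ, ψ τ = ∑ k ∈ S, ‖Torus.coeffExt S (α τ) k‖ ^ 2 := fun τ =>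
    (Torus.sum_coeffExt (fun _ v => ‖v‖ ^ 2) (α τ)).symm
  have hψ0 : ∀ τ, 0 ≤ ψ τ := fun τ => Finset.sum_nonneg fun k _ => sq_nonneg _
  -- the slice estimate `ψ' ≤ 2 (-4π²ν ψ + Φ √ψ)` (Poincaré on mean-free modes + Cauchy–Schwarz)
  have hbound : ∀ τ, 0 ≤ τ →
      ψ' τ ≤ 2 * (-(ν * (4 * Real.pi ^ 2 * ψ τ)) + Φ * Real.sqrt (ψ τ)) := by
    intro τ hτ
    have hgrad : 4 * Real.pi ^ 2 * ψ τ ≤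
        (Torus.eGradNormSq (Torus.realTrigPoly S (Torus.coeffExt S (α τ)))).toReal := by
      rw [Torus.toReal_eGradNormSq_realTrigPoly hS (hcs τ), hψS τ]
      exact mul_le_mul_of_nonneg_left (sum_norm_sq_le_sum_freqNormSq_mul (hc0 τ hτ))
        (by positivity)
    have hforce : ∫ x, ⟪Torus.realTrigPoly S (Torus.coeffExt S g) x,
        Torus.realTrigPoly S (Torus.coeffExt S (α τ)) x⟫_ℝ ≤ Φ * Real.sqrt (ψ τ) := by
      rw [Torus.integral_inner_realTrigPoly_realTrigPoly hS hgs (hcs τ), hψS τ]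
      refine (sum_re_inner_le_sqrt_mul_sqrt S _ _).trans
        (mul_le_mul_of_nonneg_right ?_ (Real.sqrt_nonneg _))
      calc Real.sqrt (∑ k ∈ S, ‖Torus.coeffExt S g k‖ ^ 2) ≤ Real.sqrt (Φ ^ 2) :=
            Real.sqrt_le_sqrt hgS
        _ = Φ := Real.sqrt_sq hΦ0
    have h1 : ν * (4 * Real.pi ^ 2 * ψ τ) ≤
        ν * (Torus.eGradNormSq (Torus.realTrigPoly S (Torus.coeffExt S (α τ)))).toReal :=
      mul_le_mul_of_nonneg_left hgrad hν.le
    show 2 * (-(ν * (Torus.eGradNormSq (Torus.realTrigPoly S (Torus.coeffExt S (α τ)))).toReal) +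
      ∫ x, ⟪Torus.realTrigPoly S (Torus.coeffExt S g) x,
        Torus.realTrigPoly S (Torus.coeffExt S (α τ)) x⟫_ℝ) ≤ _
    linarith
  -- barrier: `ψ t ≤ (R + δ)²` for every `δ > 0`
  have hkey : ∀ δ, 0 < δ → ψ t ≤ (R + δ) ^ 2 := by
    intro δ hδ
    have hRδ : 0 < R + δ := by linarith
    have hmain := image_le_of_deriv_right_lt_deriv_boundary' (f := ψ) (f' := ψ') (a := 0) (b := t)
      (B := fun _ => (R + δ) ^ 2) (B' := fun _ => 0)
      (fun τ hτ => (hasDerivWithinAt_energy ν hS (hsol.hasDerivWithinAt t τ hτ) (hsol.mem τ)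
        hg).continuousWithinAt)
      (fun τ hτ => hasDerivWithinAt_energy ν hS (hsol.hasDerivWithinAt_Ici hτ) (hsol.mem τ) hg)
      ?_ continuousOn_const (fun x _ => hasDerivWithinAt_const x (Ici x) ((R + δ) ^ 2)) ?_
    · exact hmain (right_mem_Icc.2 ht)
    · -- the datum: `ψ 0 = Σ ‖c₀ k‖² ≤ R² ≤ (R + δ)²`
      show ∑ k, ‖α 0 k‖ ^ 2 ≤ (R + δ) ^ 2
      rw [hsol.initial]
      exact hc₀R.trans (pow_le_pow_left₀ hR0 (by linarith) 2)
    · -- on the sphere `ψ = (R + δ)²` the energy strictly decreases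
      intro x hx hxB
      have hxB' : ψ x = (R + δ) ^ 2 := hxB
      have hb := hbound x hx.1
      rw [hxB', Real.sqrt_sq hRδ.le] at hb
      have h1 : Φ * (R + δ) ≤ 4 * Real.pi ^ 2 * ν * R * (R + δ) :=
        mul_le_mul_of_nonneg_right hΦR hRδ.le
      have h2 : 0 < 4 * Real.pi ^ 2 * ν * δ * (R + δ) := mul_pos (mul_pos hπν hδ) hRδ
      show ψ' x < 0
      linarith
  -- `δ → 0`
  have hsqrt : Real.sqrt (ψ t) ≤ R :=
    le_of_forall_pos_le_add fun δ hδ => Real.sqrt_le_iff.2 ⟨by linarith, hkey δ hδ⟩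
  show ψ t ≤ R ^ 2
  calc ψ t = Real.sqrt (ψ t) ^ 2 := (Real.sq_sqrt (hψ0 t)).symm
    _ ≤ R ^ 2 := pow_le_pow_left₀ (Real.sqrt_nonneg _) hsqrt 2

/-- **S5 — THE ABSORBING BALL.** For `ν > 0`, a smooth force `f`, a Galerkin mode `a` of order
`N` whose forward orbit slices `Torus.galerkinFlow ν f N t a` (`t ≥ 0`) have zero mean, and a
radius `R ≥ ‖f‖₂ / (4π²ν)`: if `‖a‖₂² ≤ R²` then `‖galerkinFlow ν f N t a‖₂² ≤ R²` for all
`t ≥ 0`. Proof: pass to the coefficient orbit `galerkinCoeffFlow ν (f̂|_{≤N}) t (â|_{≤N})`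
(`IsGalerkinMode.galerkinFlow_eq`, Parseval `Torus.integral_norm_sq_realTrigPoly`), whose mean
mode vanishes (`Torus.mFourierCoeff_complexify_zero_of_hasZeroMean`) and whose force satisfies
Bessel `‖P_N f‖₂ ≤ ‖f‖₂` (`Torus.integral_norm_sq_fourierTruncate_le`), and apply the coefficient
barrier `sum_norm_sq_le_of_barrier` (exact energy identity + Poincaré on mean-zero fields +
Cauchy–Schwarz + barrier). [folklore; Constantin–Foias 1988, Ch. 8, (8.7)–(8.9); Temam 1997,
Ch. III, §2.2] -/
theorem stub_absorbingBall (ν : ℝ) (f : T3 → R3) (N : ℕ) (a : T3 → R3) (hν : 0 < ν)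
    (hf : Torus.IsSmooth f) (ha : IsGalerkinMode N a)
    (hmean : ∀ t, 0 ≤ t → Torus.HasZeroMean (Torus.galerkinFlow ν f N t a)) {R : ℝ}
    (hR : Real.sqrt (∫ x, ‖f x‖ ^ 2) / (4 * Real.pi ^ 2 * ν) ≤ R)
    (haR : ∫ x, ‖a x‖ ^ 2 ≤ R ^ 2) (t : ℝ) (ht : 0 ≤ t) :
    ∫ x, ‖Torus.galerkinFlow ν f N t a x‖ ^ 2 ≤ R ^ 2 := by
  -- the absorbing radius: `‖f‖₂ ≤ 4π²ν R`
  have hπν : 0 < 4 * Real.pi ^ 2 * ν := by positivity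
  have hF0 : 0 ≤ Real.sqrt (∫ x, ‖f x‖ ^ 2) := Real.sqrt_nonneg _
  have hFR : Real.sqrt (∫ x, ‖f x‖ ^ 2) ≤ 4 * Real.pi ^ 2 * ν * R := by
    have h := (div_le_iff₀ hπν).1 hR
    linarith
  -- the coefficient orbit `t ↦ φ_t (â|_{≤N})` driven by `f̂|_{≤N}`
  have hS : ∀ k ∈ Torus.freqBall (d := Fin 3) N, -k ∈ Torus.freqBall (d := Fin 3) N :=
    Torus.neg_mem_freqBall_of_mem
  have hgr : Torus.IsRealCoeff (fourierRestrict (Torus.freqBall (d := Fin 3) N) f) :=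
    Torus.isRealCoeff_mFourierCoeff hf.integrable
  have hsol := isGalerkinODESolution_galerkinCoeffFlow hν.le hS hgr ha.fourierRestrict_mem (ν := ν)
  -- Parseval along the orbit
  have hpars : ∀ τ, ∫ x, ‖Torus.galerkinFlow ν f N τ a x‖ ^ 2 =
      ∑ k, ‖galerkinCoeffFlow ν (fourierRestrict (Torus.freqBall N) f) τ
        (fourierRestrict (Torus.freqBall N) a) k‖ ^ 2 := by
    intro τ
    rw [ha.galerkinFlow_eq τ,
      Torus.integral_norm_sq_realTrigPoly hS ((hsol.mem τ).1.isConjSymm_coeffExt hS),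
      Torus.sum_coeffExt (fun _ v => ‖v‖ ^ 2)]
  rw [hpars t]
  refine sum_norm_sq_le_of_barrier hS (Torus.zero_mem_freqBall N) hν hgr hsol ?_ hF0 ?_ hFR ?_ ht
  · -- the mean mode vanishes along the forward orbit
    intro τ hτ
    rw [← ha.fourierRestrict_galerkinFlow τ, fourierRestrict_apply]
    exact Torus.mFourierCoeff_complexify_zero_of_hasZeroMean
      (ha.isGalerkinMode_galerkinFlow τ).isSmooth.integrable (hmean τ hτ)
  · -- the force: `Σ_{|k|≤N} ‖f̂ k‖² = ‖P_N f‖₂² ≤ ‖f‖₂²` (Bessel)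
    rw [Real.sq_sqrt (integral_nonneg fun x => sq_nonneg _),
      ← Torus.sum_coeffExt (fun _ v => ‖v‖ ^ 2) (fourierRestrict (Torus.freqBall N) f),
      ← Torus.integral_norm_sq_realTrigPoly hS (hgr.isConjSymm_coeffExt hS),
      realTrigPoly_coeffExt_fourierRestrict]
    exact Torus.integral_norm_sq_fourierTruncate_le (hf.memLp 2) N
  · -- the datum: `Σ_{|k|≤N} ‖â k‖² = ‖a‖₂²` (`P_N a = a`)
    rw [← Torus.sum_coeffExt (fun _ v => ‖v‖ ^ 2) (fourierRestrict (Torus.freqBall N) a),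
      ← Torus.integral_norm_sq_realTrigPoly hS (ha.fourierRestrict_mem.1.isConjSymm_coeffExt hS),
      ha.realTrigPoly_fourierRestrict]
    exact haR

end Summit.AnomalousDissipation.AnomalousDissipation.Theorems.MomentParityQuarticTightness

end
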